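import Summits.QuantumFields.BalabanUV.Beta.StraightSourceK1Row
import Summits.QuantumFields.BalabanUV.Beta.BorderedHessianBlind
import Summits.QuantumFields.BalabanUV.Beta.CombRootedAbsorbsSym
import Summits.QuantumFields.BalabanUV.Beta.AxialDressingRootedBmLinear
import Summits.QuantumFields.BalabanUV.Beta.GAN24.AxProjBmWindow

/-!
# `BalabanUV.Beta.BlockMeanChartK1Row` — binder row D1 ∕ (C1) OWNER an2 (gen 60), PART 7: **(K1) AT DEPTH 1 ON `ℤ^{d+1}` IN THE BLOCK-MEAN CHART OF RECORD**
# — Engine C's test T3 of `prestab/k1/K1.md` (`h = G0bm(ctr)` column = the block-mean-co-dressed minimiser, `ℓ = symLinKerAt`, `α = −81`) BY PROOF, and mechanism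
# (iii)'s second half («the block-mean dressing is a fine gradient: `E″(G0bm col) = E″(wH col)`, `𝒞(G0bm col) = 𝒞(wH col)`») as Form-level theorems

WHAT.  The co-dressed kernel's `ℋ`-column is `coProjBmW ρ N` of the straight column (an2 g12 `AxialDressingRootedBmLinear.colH_coDressKBmAt_eq`), i.e.
`h′(κ′,u′) = Σ_{v ∈ cube} Σ_κ pmBm ρ N κ′ u′ κ (u′−v) · h κ (u′−v)` — the matrix of the block-mean-normalised rooted axial projector `Π_bm` applied to `h`.
§1 `Π_bm` IS REPRESENTED BY ITS MATRIX as `HasSum` letters (in-block root, `1 ≤ N`): `hasSum_blockMeanAt_treeGaugeAt_delta1`, **`hasSum_axProjBmAt_delta1`**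
(the Bm twin of an2 g35's `CombRootedAbsorbsSym.hasSum_axProjAt_delta1`); the Form-level identity `axProjBmAt (toSite r) N A = coProjBmW (toSite r) N A` is the GAN24
swarm's `GAN24.AxProjBmWindow.axProjBmAt_eq_coProjBmW'` (gan24-p4, LANDED) and is used BY NAME below (located by leaf-03 g54's alias probe, GAPS § C-d1leaf03g53-3).
§2 MECHANISM (iii)-b: **`curvAdj_curv_coProjBmW`** (`E″(1) (Π_bm h) = E″(1) h`, by an2 g13's `BorderedHessian.curv_axProjBmAt`), **`contourSum_coProjBmW`**
(`𝒬 (Π_bm h) = 𝒬 h`, by `AxialProjectorBlockMean.contourSum_axProjBmAt`); hence **`lamCovector_coProjBmW`** (`λ′(Π_bm h) = λ′(h)` for every `h` with summable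
components: `λ′(h) = −⟨𝒬ᵀ Φ^ℋ_{(μ,y)}, h⟩ = −Σ' Φ^ℋ · 𝒬 h`; the summability of the dressed column is re-derived inline — the GAN24 swarm's
`CoDressedFieldRowSums.summable_coProjBmW` is the same statement; a uniform bound is `D1BFx.RoadPinKernelBdd.abs_coProjBmW_le_of_sup`).
§3 (K1) IN THE BLOCK-MEAN CHART for `h′ := coProjBmW (toSite r₀) N (HcolSum T c)` (every finitely supported source; `T = {(μ₀,q)}, c = 1` is T3's column):
**`K1_row_bm_source_sym`** (`(E″(1) h′)(u) = −N^{d+1}·Σ'_y Σ_μ λ′(h′)(μ,y)·symLinKerAt (toSite r) N μ y u`), `K1_row_bm_source_comb` (`α = −1`), `K1_row_bm_source_straight`,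
and the dictionary `coProjBmW_Hcol_eq_colH_coDressKBmAt` (`h′` for one column IS the `ℋ`-column of `coDressKBmAt ρ₀ N (KInv N)` — the «G0bm» kernel of record).
[folklore] finite-window ∕ `tsum` bookkeeping over the cell's OWN objects BY NAME (an2 g12∕g13∕g35 files, the GAN24 swarm's `AxProjBmWindow`, an5's straight system,
parts 1–3∕5); 0 `def`, 0 `def … : Prop`,
0 sorry, nothing cited; no table VALUE, no estimate.  The END wrapper's (K1) (tower torus, nested column, periodised coefficients) stays DISPLAYED.
NOT (C1), NOT the wrapper's (K1), NOT D1, NEVER «G-an2-4 closed», NOT BetaPertH, NOT continuum, NOT Clay.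

HONEST FRAMING (cell charter, verbatim): «discharging `BetaPertH` makes Bałaban's UV stability UNCONDITIONAL — a real constructive-QFT result; it
is NOT the continuum limit and NOT the Clay problem.»  HONEST DEPENDENCY (verbatim): «continuum YM on T⁴ ⇐ BetaPertH ∧ nine spine estimates (0/9 proved);
BetaPertH ⇐ (D1) ∧ (D4) ∧ CAP+tail; G-an2-4 gates asym, D1 and NE2/3/4.»  ABSOLUTE RULE (cell, verbatim): «No internally-minted statement may enter as a
cited fact. Every hypothesis is either kernel-proved in this package or a verbatim quotation of a PUBLISHED theorem with page reference.»
Unit `b2b-balaban-beta-an2` gen 60 (row-D1 owner), 2026-08-25; `bears_on: R4-O/T1|T1a` (moves no node counter).  No existing file touched.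
-/

noncomputable section

namespace Summit.QuantumFields.BalabanUV.Beta.BlockMeanChartK1Row

open Finset
open scoped BigOperators
open Literature.MathematicalPhysics.QuantumFieldTheory.Balaban1983to89
open Literature.MathematicalPhysics.QuantumFieldTheory.Balaban1983to89.Beta
open AffineAveraging (Form0 Form1 Form2 Site unitVec unitVec_apply dz curv curvAdj codiff₁ box toSite contourSum blockSum)
open AffineReproduction (contourSumAdj)
open AveragingContours (blk grad)
open AveragingContoursRooted (treeGaugeAt)
open AveragingHessianKernels (Bond δ1 straightCount)
open AveragingHessianKernelsRooted (linCountAt)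
open KKTFluctuationKernel (delta1 delta1_apply)
open KKTFluctuationEnergy (lip1 lip1_contourSumAdj summable_shift_sub summable_mul_of_bdd)
open ResolventComposition (Hcol HΦcol HcolSum HΦcolSum Hcol_apply curvAdj_curv_Hcol HcolSum_bdd_summable HΦcol_bdd)
open OneStepResolventKernel (Fib KInv KInv_inl_inr_coarse)
open OneStepKernelFamily (colH)
open ExpKernelCalculus (MKer)
open BalabanStepJets (lamCoeffOf)
open Summit.QuantumFields.BalabanUV.Beta.AxialDressingRooted (cube mem_cube pmBm abs_pmBm_le window_of_pmBm_ne_zero coProjBmW coProjBmW_apply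
  coDressKBmAt colH_coDressKBmAt_eq)
open Summit.QuantumFields.BalabanUV.Beta.AxialProjectorBlockMean (blockMeanAt bmGaugeAt axProjBmAt axProjBmAt_eq contourSum_axProjBmAt)
open Summit.QuantumFields.BalabanUV.Beta.BorderedHessian (bondInd_cast_eq_delta1 curv_axProjBmAt)
open Summit.QuantumFields.BalabanUV.Beta.CombRootedAbsorbsSym (hasSum_treeGaugeAt_delta1 hasSum_axProjAt_delta1)
open Summit.QuantumFields.BalabanUV.Beta.GAN24.AxProjBmWindow (axProjBmAt_eq_coProjBmW')
open RootedComb (axProjAt axProjAt_apply)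
open Summit.QuantumFields.BalabanUV.Beta.SymAveragingHessianCounts (symLinKerAt)
open Summit.QuantumFields.BalabanUV.Beta.StraightColumnK1Row (lamCovector_eq_neg_lip1 codiff₁_lamCovector)
open Summit.QuantumFields.BalabanUV.Beta.StraightSourceK1Row (lamCovector_HcolSum codiff₁_lamCovector_HcolSum abs_lamCovector_HcolSum_le
  lip1_lamCovector_HcolSum_straightCount K1_row_straight_source_sym K1_row_straight_source_comb K1_row_straight_source_straight)

variable {d : ℕ}

/-! ## §1 `Π_bm` is represented by its matrix -/

section Matrix

variable {N : ℕ} {r : Fin (d + 1) → ℕ}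

/-- [folklore] The block mean of the rooted tree gauge at a fine point is represented by its matrix (finite block sum of `hasSum_treeGaugeAt_delta1`). -/
theorem hasSum_blockMeanAt_treeGaugeAt_delta1 (hN : 1 ≤ N) (hr : r ∈ box (d + 1) N) (A : Form1 (d + 1) ℝ) (x : Fin (d + 1) → ℤ) :
    HasSum (fun w : Fin (d + 1) → ℤ => ∑ l, blockMeanAt N (treeGaugeAt (toSite r) (delta1 l w) N) x * A l w)
      (blockMeanAt N (treeGaugeAt (toSite r) A N) x) := by
  unfold blockMeanAt
  have h : HasSum (fun w : Fin (d + 1) → ℤ => ∑ l, blockSum N (treeGaugeAt (toSite r) (delta1 l w) N) (blk N x) * A l w)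
      (blockSum N (treeGaugeAt (toSite r) A N) (blk N x)) := by
    unfold blockSum
    have hs := hasSum_sum (s := box (d + 1) N)
      (f := fun b (w : Fin (d + 1) → ℤ) => ∑ l, treeGaugeAt (toSite r) (delta1 l w) N ((N : ℤ) • blk N x + toSite b) * A l w)
      (fun b _ => hasSum_treeGaugeAt_delta1 hN hr A ((N : ℤ) • blk N x + toSite b))
    refine hs.congr_fun fun w => ?_
    rw [Finset.sum_comm, ← Finset.sum_congr rfl fun l _ => (Finset.sum_mul _ _ _).symm]
  refine (h.div_const ((N : ℝ) ^ (d + 1))).congr_fun fun w => ?_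
  rw [Finset.sum_div]
  exact Finset.sum_congr rfl fun l _ => by ring

/-- [folklore] **THE BLOCK-MEAN-NORMALISED ROOTED AXIAL PROJECTOR IS REPRESENTED BY ITS MATRIX** (in-block root, `1 ≤ N`): for every fine 1-form `A`,
`Σ'_w Σ_l (Π_bm δ_{(l,w)})_κ(x) · A_l(w) = (Π_bm A)_κ(x)` (the Bm twin of `hasSum_axProjAt_delta1`, via `axProjBmAt_eq`). -/
theorem hasSum_axProjBmAt_delta1 (hN : 1 ≤ N) (hr : r ∈ box (d + 1) N) (A : Form1 (d + 1) ℝ) (κ : Fin (d + 1)) (x : Fin (d + 1) → ℤ) :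
    HasSum (fun w : Fin (d + 1) → ℤ => ∑ l, axProjBmAt (toSite r) N (delta1 l w) κ x * A l w) (axProjBmAt (toSite r) N A κ x) := by
  have h1 := hasSum_axProjAt_delta1 hN hr A κ x
  have h2 := (hasSum_blockMeanAt_treeGaugeAt_delta1 hN hr A (x + unitVec κ)).sub (hasSum_blockMeanAt_treeGaugeAt_delta1 hN hr A x)
  have h := h1.add h2
  have hfun : (fun w : Fin (d + 1) → ℤ => ∑ l, axProjBmAt (toSite r) N (delta1 l w) κ x * A l w)
      = fun w => (∑ l, axProjAt (toSite r) N (delta1 l w) κ x * A l w)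
        + ((∑ l, blockMeanAt N (treeGaugeAt (toSite r) (delta1 l w) N) (x + unitVec κ) * A l w)
          - ∑ l, blockMeanAt N (treeGaugeAt (toSite r) (delta1 l w) N) x * A l w) := by
    funext w
    rw [← Finset.sum_sub_distrib, ← Finset.sum_add_distrib]
    refine Finset.sum_congr rfl fun l _ => ?_
    rw [axProjBmAt_eq, Pi.add_apply, Pi.add_apply, grad]
    ring
  rw [hfun, axProjBmAt_eq, Pi.add_apply, Pi.add_apply, grad]
  exact h

end Matrix

/-! ## §2 Mechanism (iii)-b: the block-mean dressing is invisible to `E″(1)`, to `𝒬`, and to `Λ′` -/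

section Blind

variable {N : ℕ} {r : Fin (d + 1) → ℕ}

/-- [folklore] **`E″(1)` IS BLIND TO THE BLOCK-MEAN DRESSING**: `curvAdj (curv (coProjBmW (toSite r) N A)) = curvAdj (curv A)` (`curv ∘ grad = 0`). -/
theorem curvAdj_curv_coProjBmW (hN : 1 ≤ N) (hr : r ∈ box (d + 1) N) (A : Form1 (d + 1) ℝ) :
    curvAdj (curv (coProjBmW (toSite r) N A)) = curvAdj (curv A) := by
  rw [← axProjBmAt_eq_coProjBmW' hN hr A, curv_axProjBmAt]

/-- [folklore] **`𝒬` IS BLIND TO THE BLOCK-MEAN DRESSING**: `contourSum N (coProjBmW (toSite r) N A) = contourSum N A` (the block means of the gauge vanish). -/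
theorem contourSum_coProjBmW (hN : 1 ≤ N) (hr : r ∈ box (d + 1) N) (A : Form1 (d + 1) ℝ) :
    contourSum N (coProjBmW (toSite r) N A) = contourSum N A := by
  rw [← axProjBmAt_eq_coProjBmW' hN hr A, contourSum_axProjBmAt _ hN]

variable [NeZero N]

/-- [folklore] **`Λ′` IS BLIND TO THE BLOCK-MEAN DRESSING**: for every fine field `h` with summable components (no bound needed),
`λ′(Π_bm h)(μ, y) = λ′(h)(μ, y)` — `λ′(h) = −⟨E″(1)ℋ_{(μ,y)}, h⟩ = −⟨𝒬ᵀ Φ^ℋ_{(μ,y)}, h⟩ = −Σ' Φ^ℋ · 𝒬 h` and `𝒬 (Π_bm h) = 𝒬 h`. -/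
theorem lamCovector_coProjBmW (hN : 1 ≤ N) (hr : r ∈ box (d + 1) N) {h : Form1 (d + 1) ℝ} (hs : ∀ κ, Summable (h κ))
    (μ : Fin (d + 1)) (y : Site (d + 1)) :
    (∑' x, ∑ κ', lamCoeffOf (KInv (N := N)) N μ y κ' x * coProjBmW (toSite r) N h κ' x)
      = ∑' x, ∑ κ', lamCoeffOf (KInv (N := N)) N μ y κ' x * h κ' x := by
  obtain ⟨CΦ, _, hΦ⟩ := HΦcol_bdd (N := N) (d := d)
  -- the dressed column of a summable field is summable: a finite window combination of shifted copies with bounded coefficients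
  -- (the GAN24 swarm's `CoDressedFieldRowSums.summable_coProjBmW` is the same statement; re-derived inline to keep the import cone small)
  have hs' : ∀ κ', Summable (coProjBmW (toSite r) N h κ') := by
    intro κ'
    have hw : ∀ v ∈ cube (d + 1) N, ∀ κ : Fin (d + 1),
        Summable fun u' : Fin (d + 1) → ℤ => pmBm (toSite r) N κ' u' κ (u' - v) * h κ (u' - v) :=
      fun v _ κ => summable_mul_of_bdd (fun u' => abs_pmBm_le hN hr κ' u' κ (u' - v)) (summable_shift_sub (hs κ) v)
    refine (summable_sum fun v hv => summable_sum fun κ (_ : κ ∈ Finset.univ) => hw v hv κ).congr fun u' => ?_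
    rw [coProjBmW_apply]
  rw [lamCovector_eq_neg_lip1, lamCovector_eq_neg_lip1, curvAdj_curv_Hcol]
  congr 1
  have hc : ∀ g : Form1 (d + 1) ℝ, lip1 (contourSumAdj N (HΦcol (N := N) μ y)) g = lip1 g (contourSumAdj N (HΦcol (N := N) μ y)) :=
    fun g => tsum_congr fun x => Finset.sum_congr rfl fun κ _ => mul_comm _ _
  rw [hc, hc, lip1_contourSumAdj (N := N) hs' (hΦ μ y), lip1_contourSumAdj (N := N) hs (hΦ μ y), contourSum_coProjBmW hN hr]

end Blind

/-! ## §3 (K1) in the block-mean chart -/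

section K1

variable {N : ℕ} [NeZero N] {r₀ : Fin (d + 1) → ℕ}

/-- [folklore] DICTIONARY: the straight column `ℋ_N(·; μ₀, q)` is the `ℋ`-column of `KInv N` (`KInv_inl_inr_coarse`). -/
theorem colH_KInv_eq_Hcol (μ₀ : Fin (d + 1)) (q : Site (d + 1)) : colH (KInv (N := N)) N μ₀ q = Hcol (N := N) μ₀ q := by
  funext κ' u
  rw [colH, KInv_inl_inr_coarse, Hcol_apply]

/-- [folklore] DICTIONARY: the dressed straight column is the `ℋ`-column of the block-mean-co-dressed kernel `coDressKBmAt ρ₀ N (KInv N)` — Engine C's «G0bm» chart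
(`D1BFx/TorusCombKKT.inv_MT_packed_eq`'s kernel) read on `ℤ^{d+1}`. -/
theorem coProjBmW_Hcol_eq_colH_coDressKBmAt (μ₀ : Fin (d + 1)) (q : Site (d + 1)) :
    coProjBmW (toSite r₀) N (Hcol (N := N) μ₀ q) = colH (coDressKBmAt (toSite r₀) N (KInv (N := N))) N μ₀ q := by
  rw [colH_coDressKBmAt_eq, colH_KInv_eq_Hcol]

/-- [folklore] **(K1) IN THE BLOCK-MEAN CHART, SYMMETRISED ROWS** (Engine C's T3, `α = −N^{d+1}`): for `h′ := coProjBmW (toSite r₀) N (Σ_{t∈T} c t · ℋ_N(·; t))`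
(in-block dressing root `r₀`, in-block averaging root `r`) and every fine bond `u`,
`(E″(1) h′)(u) = −N^{d+1} · Σ'_y Σ_μ λ′(h′)(μ,y) · symLinKerAt (toSite r) N μ y u`. -/
theorem K1_row_bm_source_sym (hr₀ : r₀ ∈ box (d + 1) N) (T : Finset (Fin (d + 1) × Site (d + 1))) (c : Fin (d + 1) × Site (d + 1) → ℝ)
    {r : Fin (d + 1) → ℕ} (hr : r ∈ box (d + 1) N) (u : Bond (d + 1)) :
    curvAdj (curv (coProjBmW (toSite r₀) N (HcolSum (N := N) T c))) u.1 u.2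
      = -((N : ℝ) ^ (d + 1)) * ∑' y, ∑ μ,
          (∑' x, ∑ κ', lamCoeffOf (KInv (N := N)) N μ y κ' x * coProjBmW (toSite r₀) N (HcolSum (N := N) T c) κ' x)
          * symLinKerAt (toSite r) N μ y u := by
  have hN : 1 ≤ N := Nat.one_le_iff_ne_zero.2 (NeZero.ne N)
  obtain ⟨C, _, hHs, _⟩ := HcolSum_bdd_summable (N := N) T c
  simp_rw [lamCovector_coProjBmW hN hr₀ hHs]
  rw [curvAdj_curv_coProjBmW hN hr₀]
  exact K1_row_straight_source_sym T c hr u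

/-- [folklore] **(K1) IN THE BLOCK-MEAN CHART, ROOTED COMB ROWS** (`α = −1`). -/
theorem K1_row_bm_source_comb (hr₀ : r₀ ∈ box (d + 1) N) (T : Finset (Fin (d + 1) × Site (d + 1))) (c : Fin (d + 1) × Site (d + 1) → ℝ)
    {r : Fin (d + 1) → ℕ} (hr : r ∈ box (d + 1) N) (u : Bond (d + 1)) :
    curvAdj (curv (coProjBmW (toSite r₀) N (HcolSum (N := N) T c))) u.1 u.2
      = -∑' y, ∑ μ, (∑' x, ∑ κ', lamCoeffOf (KInv (N := N)) N μ y κ' x * coProjBmW (toSite r₀) N (HcolSum (N := N) T c) κ' x)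
          * (linCountAt (toSite r) N μ y u : ℝ) := by
  have hN : 1 ≤ N := Nat.one_le_iff_ne_zero.2 (NeZero.ne N)
  obtain ⟨C, _, hHs, _⟩ := HcolSum_bdd_summable (N := N) T c
  simp_rw [lamCovector_coProjBmW hN hr₀ hHs]
  rw [curvAdj_curv_coProjBmW hN hr₀]
  exact K1_row_straight_source_comb T c hr u

/-- [folklore] **(K1) IN THE BLOCK-MEAN CHART, STRAIGHT ROWS** (`α = −1`). -/
theorem K1_row_bm_source_straight (hr₀ : r₀ ∈ box (d + 1) N) (T : Finset (Fin (d + 1) × Site (d + 1))) (c : Fin (d + 1) × Site (d + 1) → ℝ)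
    (u : Bond (d + 1)) :
    curvAdj (curv (coProjBmW (toSite r₀) N (HcolSum (N := N) T c))) u.1 u.2
      = -∑' y, ∑ μ, (∑' x, ∑ κ', lamCoeffOf (KInv (N := N)) N μ y κ' x * coProjBmW (toSite r₀) N (HcolSum (N := N) T c) κ' x)
          * (straightCount N μ y u : ℝ) := by
  have hN : 1 ≤ N := Nat.one_le_iff_ne_zero.2 (NeZero.ne N)
  obtain ⟨C, _, hHs, _⟩ := HcolSum_bdd_summable (N := N) T c
  simp_rw [lamCovector_coProjBmW hN hr₀ hHs]
  rw [curvAdj_curv_coProjBmW hN hr₀]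
  exact K1_row_straight_source_straight T c u

end K1

end Summit.QuantumFields.BalabanUV.Beta.BlockMeanChartK1Row

end
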